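import Summits.BirchSwinnertonDyer.Rank1Residual.X2.GreenbergVatsalTorsionCurve
import HarnessLib

/-!
# Greenberg–Vatsal 2000, Prop. (2.8) under REMARK (2.9): the torsion comparison
# `S^{Σ₀}_{A[π]}(ℚ_∞) ↔ S^{Σ₀}_A(ℚ_∞)[π]` when `H⁰(I_p, D)` is DIVISIBLE — in particular when
# `D^{I_p} = 0`, the case of EVERY additive potentially ordinary datum (ramified quotient) — in the
# kernel, generalising eisenstein-p2's `X2.GreenbergVatsalTorsion` (`I_p` acts trivially on `D`)
# (cell `b2b-bsdres`, team n1011, seat p12 (gen 4); row T-E3g-GV29; serves ROUTE-2 II.15.4 arms α / γ)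

HONEST FRAMING (cell `b2b-bsdres`, run/shared/lean/b2b/bsd-rank1-residual/, verbatim in every
file): the goal of the cell is to DELETE the COMBINATION-SHAPED residual classes of the
Birch–Swinnerton-Dyer formula for ALL analytic-rank `≤ 1` elliptic curves over `ℚ` — "full BSD
formula for every rank `≤ 1` curve in class `C`" assembled STRICTLY from published theorems — so
that the rank-`≤ 1` remainder becomes exactly the CONSTRUCTION-SHAPED classes, which are TYPED
(missing-input `Prop`s), NOT attempted. This is not "finishing BSD". Team n1011 (N10/N11: X4 ∧
`p = 3`; X3♯): research routes on CONSTRUCTION-SHAPED classes; prove what is provable now; no claim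
beyond stated classes; census output = EVIDENCE / conjecture items, never a Literature fact;
RESIDUAL-MAP marks UNCHANGED; nothing is booked by this file. THEOREMS ONLY: no definition, no named
fact, no conjecture node; eisenstein-p2's `X2/TorsionComparison*.lean` / `X2/GreenbergVatsalTorsion*.lean`
are consumed BY NAME and untouched.

## What and why

Greenberg–Vatsal, Invent. Math. 142 (2000), §2 Prop. (2.8) (p. 25): "Assume that `I_p` acts
trivially on `D` and that `H⁰(ℚ, A[π]) = 0`. Then `S^{Σ₀}_A(ℚ_∞)[π] = S^{Σ₀}_{A[π]}(ℚ_∞)`", whose local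
step at `p` is "the map `H¹(I_p, D[π]) → H¹(I_p, D)` is injective because `H⁰(I_p, D) = D` is
divisible"; and **Remark (2.9)** (p. 26), verbatim: "The hypothesis that `I_p` acts trivially on `D`
is adequate for the theorems stated in the introduction. But all that is needed in the proof is that
`H⁰(I_p, D)` is divisible. Thus, if `D^{I_p} = 0`, the conclusion is still true."

eisenstein-p2's kernel proof (`X2.GreenbergVatsalTorsion.mem_gvSelmer_torsion_iff`,
`natCard_gvSelmer_torsion[_of_finite]`; ANY number field `K`, normal `H ≤ Γ_K`, discrete `Γ_K`-module
`M`, data `(M⁺_v)_{v∣p}`) carries the PRINTED hypothesis `htriv : I_v` acts trivially on `M/M⁺_v`. At an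
ADDITIVE potentially ordinary prime of `E/ℚ` the datum is the RAMIFIED ordinary line `C`
(`EmertonPollackWeston2006.IsRamifiedOrdinaryLine`; p10 / p07 line files), inertia acts on
`D = E[p^∞]/C` through a NON-TRIVIAL character of order prime to `p`, and `htriv` FAILS — but
`D^{I} = 0`, so Remark (2.9) applies. Route planner 2 (ROUTE-2 II.15.4) flags exactly this as the point
on which the reducible / additive transfer (ARM α, typer option T1) and the character port (ARM γ)
rest ("a verdict 'Prop (2.8) needs `D` unramified beyond Remark (2.9)' would kill T1"). THIS FILE
settles it IN THE KERNEL — no verdict needed: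

* §1 (local algebra) `resH1Hom_id_injective_of_divisible_invariants`: for an `I`-equivariant
  injection `κ : Q' ↪ Q` with `n·Q' = 0` and `κ(Q') ⊇ Q[n]`, the map `H¹(I, Q') → H¹(I, Q)` on
  continuous classes is injective as soon as `H⁰(I, Q)` is `n`-divisible INSIDE ITSELF
  (`∀ a ∈ Q^I, ∃ q₀ ∈ Q^I, n q₀ = a`; automatic when `Q^I = 0`, and when `I` acts trivially on an
  `n`-divisible `Q` — the printed case); `localCondition_iff_of_divisible_invariants`.
* §2 (GV level) `mem_greenbergKer_torsion_iff_of_divisible_invariants` — Greenberg's condition at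
  `v ∣ p` corresponds under `α = ι_*` for a datum with `M⁺_v` `n`-divisible and `H⁰(H ⊓ I_v, M/M⁺_v)`
  `n`-divisible; `mem_gvSelmer_torsion_iff_of_divisible_invariants`; the comparison theorems
  `map_gvSelmer_torsion_eq_…`, `natCard_gvSelmer_torsion_…[_of_finite]`,
  `gvSelmerAlpha_bijective_…` (eisenstein-p2's `TorsionComparisonLocal` §4 BY NAME).
* §3–§4 the case **`(M/M⁺_v)^{H ⊓ I_v} = 0`** (Remark (2.9)'s "Thus, if `D^{I_p} = 0`"):
  `…_of_invariants_eq_bot` forms, and the curve forms for `A = E[p^∞]` over any `L = K̄^H`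
  (continuity / divisibility / unramified-away as in eisenstein-p2's `GreenbergVatsalTorsionCurve`).

NOT here: `Sel_{p^∞}(E/ℚ_∞) =` datum Selmer group at an additive `p` (T-RD-Δ, p05 + typer); the
discharge of `D^{H ⊓ I_p} = 0` from `IsRamifiedOrdinaryLine` (separate lemma: the quotient character has
order prime to `p`, so it stays non-trivial on the pro-`p`-index subgroup `I_p ∩ G_{ℚ_∞}`); Prop. (2.5)
and the second half of (2.8) (typed elsewhere); anything about a particular curve.
References: [GreenbergVatsal2000] §2 Prop. (2.8) p. 25, Remark (2.9) p. 26 (held text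
`paper:arxiv-math_9906215`; decoded copy HOME/b2b-bsdres-lit/u1/gv2000_decoded.txt l. 104–106);
ROUTE-2 II.15.3–4; eisenstein-p2 `X2/TorsionComparison[Local].lean`, `X2/GreenbergVatsalTorsion[Curve].lean`.
-/

set_option autoImplicit false

noncomputable section

open scoped Classical AddSubgroup
universe u

open NumberField IsDedekindDomain Field
open Literature.NumberTheory.EllipticCurves Literature.NumberTheory.EllipticCurves.GreenbergSelmer
  Literature.NumberTheory.GaloisRepresentations
  Summit.BirchSwinnertonDyer.Rank1Residual.X2.TorsionComparison
  Summit.BirchSwinnertonDyer.Rank1Residual.X2.GreenbergVatsalTorsion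

namespace Summit.BirchSwinnertonDyer.Rank1Residual.Additive.GreenbergVatsalTorsionRamified

/-! ## §1. Local algebra: `H¹(I, Q[n]) → H¹(I, Q)` is injective when `H⁰(I, Q)` is `n`-divisible -/

section Local

variable {G : Type u} [Group G] [TopologicalSpace G] [IsTopologicalGroup G]
variable {M : Type u} [AddCommGroup M] [DistribMulAction G M] [TopologicalSpace M]
  [DiscreteTopology M]
variable {I : Type u} [Group I] [TopologicalSpace I] [IsTopologicalGroup I]
variable {Q : Type u} [AddCommGroup Q] [DistribMulAction I Q] [TopologicalSpace Q]
  [DiscreteTopology Q]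
variable {Q' : Type u} [AddCommGroup Q'] [DistribMulAction I Q'] [TopologicalSpace Q']
  [DiscreteTopology Q']

/-- **GV Remark (2.9), the local mechanism.** Let `κ : Q' ↪ Q` be an injective `I`-equivariant map
with `n · Q' = 0` whose image contains `Q[n]` (so `Q' ≅ Q[n]`), and assume `H⁰(I, Q) = Q^I` is
`n`-divisible inside itself. Then `κ_* : H¹(I, Q') → H¹(I, Q)` (continuous classes) is injective:
if `κ ∘ f = ∂q`, then `n q ∈ Q^I`, so `n q = n q₀` with `q₀ ∈ Q^I`, `q − q₀ ∈ Q[n] = κ(Q')`, say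
`= κ t`, and `f = ∂t`. Generalises eisenstein-p2's `resH1Hom_id_injective_of_trivial` (`I` trivial
on `Q`: there `H⁰(I, Q) = Q` "is divisible"). [cite: GreenbergVatsal2000, §2 Prop. (2.8) (proof, p. 25) and Remark (2.9) (p. 26)] -/
theorem resH1Hom_id_injective_of_divisible_invariants {n : ℕ}
    (hdivI : ∀ a ∈ invariants I Q, ∃ q₀ ∈ invariants I Q, n • q₀ = a)
    (κ : Q' →+ Q) (hκ : ∀ (x : I) (q' : Q'), κ (ContinuousMonoidHom.id I x • q') = x • κ q')
    (hinj : Function.Injective κ) (hQ' : ∀ q' : Q', n • q' = 0)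
    (hsat : ∀ q : Q, n • q = 0 → ∃ q' : Q', κ q' = q) :
    Function.Injective (resH1Hom (ContinuousMonoidHom.id I) κ hκ) := by
  rw [injective_iff_map_eq_zero]
  intro c hc
  obtain ⟨f, rfl⟩ := classHom_surjective (G := I) (M := Q') c
  rw [classHom_apply, resH1Hom_id_oneCocycleClass, oneCocycleClass_eq_zero_iff] at hc
  obtain ⟨q, hq⟩ := hc
  have hq' : ∀ g : I, κ (f.1 g) = g • q - q := fun g ↦ hq g
  have hκ' : ∀ (x : I) (q' : Q'), κ (x • q') = x • κ q' := fun x q' ↦ hκ x q'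
  -- `n • q` is `I`-invariant
  have hnq : n • q ∈ invariants I Q := by
    rw [mem_invariants_iff]
    intro g
    have h1 : n • (g • q - q) = 0 := by
      rw [← hq' g, ← map_nsmul, hQ', map_zero]
    rw [smul_sub, sub_eq_zero] at h1
    rw [smul_comm g n q, h1]
  obtain ⟨q₀, hq₀, hnq₀⟩ := hdivI _ hnq
  have hq₀' : ∀ g : I, g • q₀ = q₀ := (mem_invariants_iff q₀).1 hq₀
  obtain ⟨t, ht⟩ := hsat (q - q₀) (by rw [smul_sub, hnq₀, sub_self])
  rw [classHom_apply, oneCocycleClass_eq_zero_iff]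
  refine ⟨t, fun g ↦ hinj ?_⟩
  change κ (f.1 g) = κ (g • t - t)
  rw [map_sub, hκ', ht, hq', smul_sub, hq₀' g]
  abel

/-- **Local conditions of Greenberg type correspond under `α` — Remark (2.9) form.** As
eisenstein-p2's `TorsionComparisonLocal.localCondition_iff`, with "`I` acts trivially on `Q`"
replaced by "`H⁰(I, Q)` is `n`-divisible inside itself" + "`κ(Q') ⊇ Q[n]`, `n·Q' = 0`": for every
`c ∈ H¹(G, M[n])`, `res_{(φ,ψ')} c = 0 ↔ res_{(φ,ψ)} (α c) = 0`.
[cite: GreenbergVatsal2000, §2 Prop. (2.8) (proof, p. 25) and Remark (2.9) (p. 26)] -/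
theorem localCondition_iff_of_divisible_invariants {n : ℕ}
    (hdivI : ∀ a ∈ invariants I Q, ∃ q₀ ∈ invariants I Q, n • q₀ = a) (φ : I →ₜ* G)
    (ψ : M →+ Q) (h : ∀ (x : I) (m : M), ψ (φ x • m) = x • ψ m)
    (ψ' : M[(n : ℤ)] →+ Q') (h' : ∀ (x : I) (m : M[(n : ℤ)]), ψ' (φ x • m) = x • ψ' m)
    (κ : Q' →+ Q) (hκ : ∀ (x : I) (q' : Q'), κ (ContinuousMonoidHom.id I x • q') = x • κ q')
    (hinj : Function.Injective κ) (hQ' : ∀ q' : Q', n • q' = 0)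
    (hsat : ∀ q : Q, n • q = 0 → ∃ q' : Q', κ q' = q)
    (hsq : ∀ m : M[(n : ℤ)], κ (ψ' m) = ψ (m : M))
    (c : discreteH1 G (M[(n : ℤ)])) :
    resH1Hom φ ψ' h' c = 0 ↔ resH1Hom φ ψ h (torsionToH1 G M n c) = 0 := by
  have hcomp : resH1Hom φ ψ h (torsionToH1 G M n c) =
      resH1Hom (ContinuousMonoidHom.id I) κ hκ (resH1Hom φ ψ' h' c) := by
    rw [torsionToH1, resH1Hom_resH1Hom, resH1Hom_resH1Hom]
    exact congrFun (congrArg DFunLike.coe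
      (resH1Hom_congr (by ext; rfl) (by ext m; exact (hsq m).symm) _ _)) c
  rw [hcomp, map_eq_zero_iff _
    (resH1Hom_id_injective_of_divisible_invariants hdivI κ hκ hinj hQ' hsat)]

end Local

/-! ## §2. GV level: Greenberg's condition at `v ∣ p` under `α` for a datum with DIVISIBLE
`H⁰(H ⊓ I_v, M/M⁺_v)`; the comparison theorems -/

section Main

variable {K : Type u} [Field K] [NumberField K]
variable (H : Subgroup (absoluteGaloisGroup K)) [H.Normal] (M : Type u) [AddCommGroup M]
  [DistribMulAction (absoluteGaloisGroup K) M] [TopologicalSpace M] [DiscreteTopology M]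
  (p : ℕ) (L : Data K M p) (S₀ : Set (HeightOneSpectrum (𝓞 K))) (n : ℕ)

omit [H.Normal] in
/-- **Greenberg's condition at `v ∣ p` corresponds under `α` — Remark (2.9) form.** For a local
datum `N = M⁺_v` with `M⁺_v` `n`-divisible and `H⁰(H ⊓ I_v, M/M⁺_v)` `n`-divisible inside itself
(e.g. `= 0`): `c ∈` Greenberg's kernel for `M[n]` (datum `M[n] ∩ M⁺_v`) `↔ α c ∈` Greenberg's kernel
for `M`. eisenstein-p2's `mem_greenbergKer_torsion_iff` is the case "`I_v` trivial on `M/M⁺_v`".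
[cite: GreenbergVatsal2000, §2 Prop. (2.8) (proof, p. 25) and Remark (2.9) (p. 26)] -/
theorem mem_greenbergKer_torsion_iff_of_divisible_invariants {v : HeightOneSpectrum (𝓞 K)}
    (N : LocalDatum K M v) (hplus : ∀ c ∈ N.plus, ∃ c' ∈ N.plus, n • c' = c)
    (hdivI : ∀ a ∈ invariants (inertiaIn H v) N.Gr,
      ∃ q₀ ∈ invariants (inertiaIn H v) N.Gr, n • q₀ = a)
    (c : subgroupH1 H (M[(n : ℤ)])) :
    c ∈ (torsionDatum N n).greenbergKer H ↔ torsionToH1 H M n c ∈ N.greenbergKer H := by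
  rw [LocalDatum.mem_greenbergKer_iff, LocalDatum.mem_greenbergKer_iff, LocalDatum.greenbergMap,
    LocalDatum.greenbergMap]
  refine localCondition_iff_of_divisible_invariants hdivI (inertiaInToH H v) N.grMk
    (fun _ _ ↦ rfl) (torsionDatum N n).grMk (fun _ _ ↦ rfl) (grIncl N n) (grIncl_smul H N n)
    (grIncl_injective N n) (fun q' ↦ ?_) (fun q hq ↦ ?_) (fun _ ↦ rfl) c
  · obtain ⟨m, rfl⟩ := (torsionDatum N n).grMk_surjective q'
    rw [← map_nsmul, AddSubgroup.torsionBy.nsmul, map_zero]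
  · obtain ⟨m, rfl⟩ := N.grMk_surjective q
    have hnm : n • m ∈ N.plus := by
      rw [← N.ker_grMk, AddMonoidHom.mem_ker, map_nsmul]
      exact hq
    obtain ⟨c', hc', hc'eq⟩ := hplus _ hnm
    have hmc : m - c' ∈ M[(n : ℤ)] := by
      rw [AddSubgroup.torsionBy.nsmul_iff, smul_sub, hc'eq, sub_self]
    refine ⟨(torsionDatum N n).grMk ⟨m - c', hmc⟩, ?_⟩
    rw [grIncl_grMk]
    change N.grMk (m - c') = N.grMk m
    rw [map_sub, sub_eq_self, ← AddMonoidHom.mem_ker, N.ker_grMk]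
    exact hc'

/-- **The local conditions of `S^{S₀}_{M[n]}(L)` and `S^{S₀}_M(L)` correspond EXACTLY under `α`
— Remark (2.9) form**: `M` unramified at the finite `v ∉ S₀`, `v ∤ p`; at `v ∣ p`, `M⁺_v`
`n`-divisible and `H⁰(H ⊓ I_v, M/M⁺_v)` `n`-divisible inside itself (in particular `= 0`). NO
hypothesis on `H⁰(L, M)`. [cite: GreenbergVatsal2000, §2 Prop. (2.8) (proof, p. 25) and Remark (2.9) (p. 26)] -/
theorem mem_gvSelmer_torsion_iff_of_divisible_invariants
    (hunr : ∀ v : HeightOneSpectrum (𝓞 K), v ∉ S₀ → ((p : ℕ) : 𝓞 K) ∉ v.asIdeal →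
      ∀ x ∈ inertia v, ∀ m : M, x • m = m)
    (hplus : ∀ (v : HeightOneSpectrum (𝓞 K)) (hv : ((p : ℕ) : 𝓞 K) ∈ v.asIdeal),
      ∀ c ∈ (L v hv).plus, ∃ c' ∈ (L v hv).plus, n • c' = c)
    (hdivI : ∀ (v : HeightOneSpectrum (𝓞 K)) (hv : ((p : ℕ) : 𝓞 K) ∈ v.asIdeal),
      ∀ a ∈ invariants (inertiaIn H v) (L v hv).Gr,
        ∃ q₀ ∈ invariants (inertiaIn H v) (L v hv).Gr, n • q₀ = a)
    (c : subgroupH1 H (M[(n : ℤ)])) :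
    c ∈ gvSelmer H (M[(n : ℤ)]) p (torsionData L n) S₀ ↔
      torsionToH1 H M n c ∈ gvSelmer H M p L S₀ := by
  rw [mem_gvSelmer_iff, mem_gvSelmer_iff]
  refine and_congr (forall₄_congr fun v hv hvp σ ↦ ?_) (forall₃_congr fun v hv σ ↦ ?_)
  · rw [conjH1_torsionToH1, mem_unramKer_torsion_iff H M n (hunr v hv hvp)]
  · rw [conjH1_torsionToH1]
    exact mem_greenbergKer_torsion_iff_of_divisible_invariants H M n (L v hv) (hplus v hv)
      (hdivI v hv) _

/-- **`α(S^{S₀}_{M[n]}(L)) = S^{S₀}_M(L) ⊓ H¹(H, M)[n]`** for `n`-divisible `M` — Remark (2.9) form.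
[cite: GreenbergVatsal2000, §2 Prop. (2.8) (proof, p. 25) and Remark (2.9) (p. 26)] -/
theorem map_gvSelmer_torsion_eq_of_divisible_invariants
    (hM : ∀ m : M, Continuous fun g : absoluteGaloisGroup K ↦ g • m)
    (hdiv : ∀ m : M, ∃ m' : M, n • m' = m)
    (hunr : ∀ v : HeightOneSpectrum (𝓞 K), v ∉ S₀ → ((p : ℕ) : 𝓞 K) ∉ v.asIdeal →
      ∀ x ∈ inertia v, ∀ m : M, x • m = m)
    (hplus : ∀ (v : HeightOneSpectrum (𝓞 K)) (hv : ((p : ℕ) : 𝓞 K) ∈ v.asIdeal),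
      ∀ c ∈ (L v hv).plus, ∃ c' ∈ (L v hv).plus, n • c' = c)
    (hdivI : ∀ (v : HeightOneSpectrum (𝓞 K)) (hv : ((p : ℕ) : 𝓞 K) ∈ v.asIdeal),
      ∀ a ∈ invariants (inertiaIn H v) (L v hv).Gr,
        ∃ q₀ ∈ invariants (inertiaIn H v) (L v hv).Gr, n • q₀ = a) :
    (gvSelmer H (M[(n : ℤ)]) p (torsionData L n) S₀).map (torsionToH1 H M n) =
      gvSelmer H M p L S₀ ⊓ (subgroupH1 H M)[(n : ℤ)] :=
  map_eq_inf_torsionBy _ _ (continuous_smul_subgroup H M hM) hdiv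
    (mem_gvSelmer_torsion_iff_of_divisible_invariants H M p L S₀ n hunr hplus hdivI)

/-- **`#S^{S₀}_{M[n]}(L) = #(S^{S₀}_M(L) ⊓ H¹(H, M)[n]) · #(M^H / n·M^H)`** (as `Nat.card`s) —
Remark (2.9) form: `M` `n`-divisible with continuous orbit maps, unramified at the finite
`v ∉ S₀ ∪ {v ∣ p}`, and at `v ∣ p`: `M⁺_v` `n`-divisible, `H⁰(H ⊓ I_v, M/M⁺_v)` `n`-divisible inside
itself; NO hypothesis on `M^H = H⁰(L, M)`. [cite: GreenbergVatsal2000, §2 Prop. (2.8) (proof, p. 25) and Remark (2.9) (p. 26)] -/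
theorem natCard_gvSelmer_torsion_of_divisible_invariants
    (hM : ∀ m : M, Continuous fun g : absoluteGaloisGroup K ↦ g • m)
    (hdiv : ∀ m : M, ∃ m' : M, n • m' = m)
    (hunr : ∀ v : HeightOneSpectrum (𝓞 K), v ∉ S₀ → ((p : ℕ) : 𝓞 K) ∉ v.asIdeal →
      ∀ x ∈ inertia v, ∀ m : M, x • m = m)
    (hplus : ∀ (v : HeightOneSpectrum (𝓞 K)) (hv : ((p : ℕ) : 𝓞 K) ∈ v.asIdeal),
      ∀ c ∈ (L v hv).plus, ∃ c' ∈ (L v hv).plus, n • c' = c)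
    (hdivI : ∀ (v : HeightOneSpectrum (𝓞 K)) (hv : ((p : ℕ) : 𝓞 K) ∈ v.asIdeal),
      ∀ a ∈ invariants (inertiaIn H v) (L v hv).Gr,
        ∃ q₀ ∈ invariants (inertiaIn H v) (L v hv).Gr, n • q₀ = a) :
    Nat.card (gvSelmer H (M[(n : ℤ)]) p (torsionData L n) S₀) =
      Nat.card (gvSelmer H M p L S₀ ⊓ (subgroupH1 H M)[(n : ℤ)] : AddSubgroup (subgroupH1 H M)) *
        Nat.card (invariants H M ⧸ nsmulInvariants H M n) :=
  natCard_eq _ _ (continuous_smul_subgroup H M hM) hdiv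
    (mem_gvSelmer_torsion_iff_of_divisible_invariants H M p L S₀ n hunr hplus hdivI)

/-- The same with `#(M^H / n·M^H) = #M^H[n]` when `M^H = H⁰(L, M)` is finite — Remark (2.9) form.
[cite: GreenbergVatsal2000, §2 Prop. (2.8) (proof, p. 25) and Remark (2.9) (p. 26)] -/
theorem natCard_gvSelmer_torsion_of_divisible_invariants_of_finite
    (hM : ∀ m : M, Continuous fun g : absoluteGaloisGroup K ↦ g • m)
    (hdiv : ∀ m : M, ∃ m' : M, n • m' = m)
    (hunr : ∀ v : HeightOneSpectrum (𝓞 K), v ∉ S₀ → ((p : ℕ) : 𝓞 K) ∉ v.asIdeal →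
      ∀ x ∈ inertia v, ∀ m : M, x • m = m)
    (hplus : ∀ (v : HeightOneSpectrum (𝓞 K)) (hv : ((p : ℕ) : 𝓞 K) ∈ v.asIdeal),
      ∀ c ∈ (L v hv).plus, ∃ c' ∈ (L v hv).plus, n • c' = c)
    (hdivI : ∀ (v : HeightOneSpectrum (𝓞 K)) (hv : ((p : ℕ) : 𝓞 K) ∈ v.asIdeal),
      ∀ a ∈ invariants (inertiaIn H v) (L v hv).Gr,
        ∃ q₀ ∈ invariants (inertiaIn H v) (L v hv).Gr, n • q₀ = a)
    [Finite (invariants H M)] :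
    Nat.card (gvSelmer H (M[(n : ℤ)]) p (torsionData L n) S₀) =
      Nat.card (gvSelmer H M p L S₀ ⊓ (subgroupH1 H M)[(n : ℤ)] : AddSubgroup (subgroupH1 H M)) *
        Nat.card ((invariants H M)[(n : ℤ)]) :=
  natCard_eq_of_finite_invariants _ _ (continuous_smul_subgroup H M hM) hdiv
    (mem_gvSelmer_torsion_iff_of_divisible_invariants H M p L S₀ n hunr hplus hdivI)

/-- **GV Prop. (2.8) as printed, under Remark (2.9)'s local hypothesis**: if moreover
`M^H = H⁰(L, M)` is finite WITHOUT `n`-torsion (GV: `H⁰(ℚ, A[π]) = 0`), then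
`α : S^{S₀}_{M[n]}(L) → S^{S₀}_M(L) ⊓ H¹(H, M)[n]` is a BIJECTION.
[cite: GreenbergVatsal2000, §2 Prop. (2.8) (p. 25) and Remark (2.9) (p. 26)] -/
theorem gvSelmerAlpha_bijective_of_divisible_invariants_of_noTorsionInvariants
    (hM : ∀ m : M, Continuous fun g : absoluteGaloisGroup K ↦ g • m)
    (hdiv : ∀ m : M, ∃ m' : M, n • m' = m)
    (hunr : ∀ v : HeightOneSpectrum (𝓞 K), v ∉ S₀ → ((p : ℕ) : 𝓞 K) ∉ v.asIdeal →
      ∀ x ∈ inertia v, ∀ m : M, x • m = m)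
    (hplus : ∀ (v : HeightOneSpectrum (𝓞 K)) (hv : ((p : ℕ) : 𝓞 K) ∈ v.asIdeal),
      ∀ c ∈ (L v hv).plus, ∃ c' ∈ (L v hv).plus, n • c' = c)
    (hdivI : ∀ (v : HeightOneSpectrum (𝓞 K)) (hv : ((p : ℕ) : 𝓞 K) ∈ v.asIdeal),
      ∀ a ∈ invariants (inertiaIn H v) (L v hv).Gr,
        ∃ q₀ ∈ invariants (inertiaIn H v) (L v hv).Gr, n • q₀ = a)
    [Finite (invariants H M)] (h0 : ∀ m ∈ invariants H M, n • m = 0 → m = 0) :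
    Function.Bijective (alphaOn (gvSelmer H M p L S₀)
      (gvSelmer H (M[(n : ℤ)]) p (torsionData L n) S₀)
      (mem_gvSelmer_torsion_iff_of_divisible_invariants H M p L S₀ n hunr hplus hdivI)) :=
  alphaOn_bijective_of_noTorsionInvariants _ _ (continuous_smul_subgroup H M hM) hdiv _ h0

/-! ## §3. The case `(M/M⁺_v)^{H ⊓ I_v} = 0` — "Thus, if `D^{I_p} = 0`, the conclusion is still true" -/

omit [H.Normal] [TopologicalSpace M] [DiscreteTopology M] in
/-- `H⁰(H ⊓ I_v, M/M⁺_v) = 0` is (vacuously) `n`-divisible inside itself. [cite: GreenbergVatsal2000, §2 Remark (2.9) (p. 26)] -/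
theorem divisible_invariants_of_invariants_eq_bot {v : HeightOneSpectrum (𝓞 K)}
    (N : LocalDatum K M v) (h0 : ∀ a ∈ invariants (inertiaIn H v) N.Gr, a = 0) :
    ∀ a ∈ invariants (inertiaIn H v) N.Gr, ∃ q₀ ∈ invariants (inertiaIn H v) N.Gr, n • q₀ = a :=
  fun a ha ↦ ⟨0, (invariants (inertiaIn H v) N.Gr).zero_mem, by rw [h0 a ha, smul_zero]⟩

/-- **`#S^{S₀}_{M[n]}(L) = #(S^{S₀}_M(L) ⊓ H¹(H, M)[n]) · #(M^H / n·M^H)` when `D_v^{H ⊓ I_v} = 0` at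
every `v ∣ p`** (ramified quotient; `M⁺_v` `n`-divisible) — Remark (2.9)'s stated case.
[cite: GreenbergVatsal2000, §2 Prop. (2.8) (proof, p. 25) and Remark (2.9) (p. 26)] -/
theorem natCard_gvSelmer_torsion_of_invariants_eq_bot
    (hM : ∀ m : M, Continuous fun g : absoluteGaloisGroup K ↦ g • m)
    (hdiv : ∀ m : M, ∃ m' : M, n • m' = m)
    (hunr : ∀ v : HeightOneSpectrum (𝓞 K), v ∉ S₀ → ((p : ℕ) : 𝓞 K) ∉ v.asIdeal →
      ∀ x ∈ inertia v, ∀ m : M, x • m = m)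
    (hplus : ∀ (v : HeightOneSpectrum (𝓞 K)) (hv : ((p : ℕ) : 𝓞 K) ∈ v.asIdeal),
      ∀ c ∈ (L v hv).plus, ∃ c' ∈ (L v hv).plus, n • c' = c)
    (h0 : ∀ (v : HeightOneSpectrum (𝓞 K)) (hv : ((p : ℕ) : 𝓞 K) ∈ v.asIdeal),
      ∀ a ∈ invariants (inertiaIn H v) (L v hv).Gr, a = 0) :
    Nat.card (gvSelmer H (M[(n : ℤ)]) p (torsionData L n) S₀) =
      Nat.card (gvSelmer H M p L S₀ ⊓ (subgroupH1 H M)[(n : ℤ)] : AddSubgroup (subgroupH1 H M)) *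
        Nat.card (invariants H M ⧸ nsmulInvariants H M n) :=
  natCard_gvSelmer_torsion_of_divisible_invariants H M p L S₀ n hM hdiv hunr hplus
    fun v hv ↦ divisible_invariants_of_invariants_eq_bot H M n (L v hv) (h0 v hv)

/-- The finite form `… · #M^H[n]` when `D_v^{H ⊓ I_v} = 0` at every `v ∣ p` and `M^H` is finite.
[cite: GreenbergVatsal2000, §2 Prop. (2.8) (proof, p. 25) and Remark (2.9) (p. 26)] -/
theorem natCard_gvSelmer_torsion_of_invariants_eq_bot_of_finite
    (hM : ∀ m : M, Continuous fun g : absoluteGaloisGroup K ↦ g • m)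
    (hdiv : ∀ m : M, ∃ m' : M, n • m' = m)
    (hunr : ∀ v : HeightOneSpectrum (𝓞 K), v ∉ S₀ → ((p : ℕ) : 𝓞 K) ∉ v.asIdeal →
      ∀ x ∈ inertia v, ∀ m : M, x • m = m)
    (hplus : ∀ (v : HeightOneSpectrum (𝓞 K)) (hv : ((p : ℕ) : 𝓞 K) ∈ v.asIdeal),
      ∀ c ∈ (L v hv).plus, ∃ c' ∈ (L v hv).plus, n • c' = c)
    (h0 : ∀ (v : HeightOneSpectrum (𝓞 K)) (hv : ((p : ℕ) : 𝓞 K) ∈ v.asIdeal),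
      ∀ a ∈ invariants (inertiaIn H v) (L v hv).Gr, a = 0) [Finite (invariants H M)] :
    Nat.card (gvSelmer H (M[(n : ℤ)]) p (torsionData L n) S₀) =
      Nat.card (gvSelmer H M p L S₀ ⊓ (subgroupH1 H M)[(n : ℤ)] : AddSubgroup (subgroupH1 H M)) *
        Nat.card ((invariants H M)[(n : ℤ)]) :=
  natCard_gvSelmer_torsion_of_divisible_invariants_of_finite H M p L S₀ n hM hdiv hunr hplus
    fun v hv ↦ divisible_invariants_of_invariants_eq_bot H M n (L v hv) (h0 v hv)

end Main

/-! ## §4. The comparison for `A = E[p^∞]` over any `L = K̄^H` with a RAMIFIED quotient at `v ∣ p` -/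

section Curve

variable {K : Type u} [Field K] [NumberField K] (W : WeierstrassCurve K) [W.IsElliptic]
  (p : ℕ) [Fact p.Prime] (H : Subgroup (absoluteGaloisGroup K)) [H.Normal]
  (L : Data K (W.geomPrimaryTorsion p) p) (S₀ : Set (HeightOneSpectrum (𝓞 K)))

/-- **`#S^{S₀}_{E[p]}(L) = #(S^{S₀}_{E[p^∞]}(L) ⊓ H¹[p]) · #(E(L)[p^∞]/p)` for a datum `(C_v)_{v∣p}`
with `C_v` divisible and `(E[p^∞]/C_v)^{H ⊓ I_v} = 0`** (the ADDITIVE potentially ordinary shape: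
ramified quotient), `S₀ ⊇` the bad places `≠ p` (so `E[p^∞]` is unramified at the finite
`v ∉ S₀ ∪ {v ∣ p}`, Néron–Ogg–Shafarevich); continuity / divisibility / unramified-away are
eisenstein-p2's `GreenbergVatsalTorsionCurve` lemmas. NO hypothesis on `E(L)[p^∞]`.
[cite: GreenbergVatsal2000, §2 Prop. (2.8) (proof, p. 25) and Remark (2.9) (p. 26)]
[cite: SilvermanAEC2009, Prop. VII.4.1(a)] -/
theorem natCard_gvSelmer_torsion_curve_of_invariants_eq_bot
    (hS : ∀ v : HeightOneSpectrum (𝓞 K), v ∉ S₀ → ((p : ℕ) : 𝓞 K) ∉ v.asIdeal →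
      W.HasGoodReductionAt v)
    (hplus : ∀ (v : HeightOneSpectrum (𝓞 K)) (hv : ((p : ℕ) : 𝓞 K) ∈ v.asIdeal),
      ∀ c ∈ (L v hv).plus, ∃ c' ∈ (L v hv).plus, p • c' = c)
    (h0 : ∀ (v : HeightOneSpectrum (𝓞 K)) (hv : ((p : ℕ) : 𝓞 K) ∈ v.asIdeal),
      ∀ a ∈ invariants (inertiaIn H v) (L v hv).Gr, a = 0) :
    Nat.card (gvSelmer H ((W.geomPrimaryTorsion p)[(p : ℤ)]) p (torsionData L p) S₀) =
      Nat.card (gvSelmer H (W.geomPrimaryTorsion p) p L S₀ ⊓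
          (subgroupH1 H (W.geomPrimaryTorsion p))[(p : ℤ)] :
          AddSubgroup (subgroupH1 H (W.geomPrimaryTorsion p))) *
        Nat.card (invariants H (W.geomPrimaryTorsion p) ⧸
          nsmulInvariants H (W.geomPrimaryTorsion p) p) :=
  natCard_gvSelmer_torsion_of_invariants_eq_bot H (W.geomPrimaryTorsion p) p L S₀ p
    (X2.GreenbergVatsalTorsionCurve.continuous_smul_curve W p)
    (X2.GreenbergVatsalTorsionCurve.divisible_curve W p)
    (X2.GreenbergVatsalTorsionCurve.unramified_outside W p S₀ hS) hplus h0

/-- The same with `#(E(L)[p^∞]/p) = #E(L)[p]` when `E(L)[p^∞]` is finite (`L = ℚ_∞`, `E(ℚ)[p] = 0`: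
both `1`). [cite: GreenbergVatsal2000, §2 Prop. (2.8) (p. 25) and Remark (2.9) (p. 26)] [cite: SilvermanAEC2009, Prop. VII.4.1(a)] -/
theorem natCard_gvSelmer_torsion_curve_of_invariants_eq_bot_of_finite
    (hS : ∀ v : HeightOneSpectrum (𝓞 K), v ∉ S₀ → ((p : ℕ) : 𝓞 K) ∉ v.asIdeal →
      W.HasGoodReductionAt v)
    (hplus : ∀ (v : HeightOneSpectrum (𝓞 K)) (hv : ((p : ℕ) : 𝓞 K) ∈ v.asIdeal),
      ∀ c ∈ (L v hv).plus, ∃ c' ∈ (L v hv).plus, p • c' = c)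
    (h0 : ∀ (v : HeightOneSpectrum (𝓞 K)) (hv : ((p : ℕ) : 𝓞 K) ∈ v.asIdeal),
      ∀ a ∈ invariants (inertiaIn H v) (L v hv).Gr, a = 0)
    [hfin : Finite (FixedPoints.addSubgroup H (W.geomPrimaryTorsion p))] :
    Nat.card (gvSelmer H ((W.geomPrimaryTorsion p)[(p : ℤ)]) p (torsionData L p) S₀) =
      Nat.card (gvSelmer H (W.geomPrimaryTorsion p) p L S₀ ⊓
          (subgroupH1 H (W.geomPrimaryTorsion p))[(p : ℤ)] :
          AddSubgroup (subgroupH1 H (W.geomPrimaryTorsion p))) *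
        Nat.card ((FixedPoints.addSubgroup H (W.geomPrimaryTorsion p))[(p : ℤ)]) := by
  haveI : Finite (invariants H (W.geomPrimaryTorsion p)) := hfin
  exact natCard_gvSelmer_torsion_of_invariants_eq_bot_of_finite H (W.geomPrimaryTorsion p) p L S₀ p
    (X2.GreenbergVatsalTorsionCurve.continuous_smul_curve W p)
    (X2.GreenbergVatsalTorsionCurve.divisible_curve W p)
    (X2.GreenbergVatsalTorsionCurve.unramified_outside W p S₀ hS) hplus h0

end Curve

end Summit.BirchSwinnertonDyer.Rank1Residual.Additive.GreenbergVatsalTorsionRamified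

end
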